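import Literature.Computability.Complexity.TruthTableClosure
import HarnessLib

/-!
# Adaptive (Turing) reductions with a polynomial round budget: the query generator sees the answers so far

Topic `Computability/Complexity`, toolkit continuing `TruthTableClosure.lean` (truth-table machines
`ttAlg`, the coded-transcript accessors `cntA`/`bodA`, the flattening transducer `flatT`, the
budget `ttBudget`) and `CookReducibilityTransitive.lean` (`trans`, `run_eq_some_iff`, `condFn`).
Only the containment direction is formalised: a **bounded adaptive reduction** — a query
generator `Q ∈ FP` that computes the next query from the input *and the answer bits received so
far*, a polynomial round budget `q`, and an evaluator `D ∈ P` of `⟨x, answers⟩` — lands in `P^A`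
(Ladner–Lynch–Selman 1975, §2: polynomial-time Turing reducibility `≤ᵖ_T`; Arora–Barak 2009,
§3.4: "the machine's next query may depend on the answers to the previous ones"). This is the
shape of *binary search with an oracle* (Arora–Barak 2009, §17.2.1, proof of Lemma 17.7:
`P^{#P} = P^{PP}`), the consumer being the second half of Toda's theorem.

* `adBits Q A x i` — the first `i` answer bits: bit `i` is `[Q ⟨x, bits 0…i-1⟩ ∈ A]`
  (`adBits_succ`, `length_adBits`);
* `adLang Q q D A = {x | ⟨x, adBits … (q |x|)⟩ ∈ D}` — the reduced language (`mem_adLang_iff`);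
* `adAlg Q q D` — the oracle algorithm: while fewer than `q(|x|)` answers are in, ask
  `Q ⟨x, answers⟩`; then output `[⟨x, answers⟩ ∈ D]`; `trans_adAlg`, `run_adAlg`,
  `exists_of_mem_queries_adAlg`; `isPolyTime_adAlg` (step function `adStepS` = `condFn` of the query code `adQryS`
  `0 · Q ⟨x, flattened answers⟩` and the verdict code, guarded by the count of answers);
* **`adLang_mem_PRel`**: `adLang Q q D A ∈ P^A` (round budget `q + 1`, query lengths
  `s(2n + 2 + q n)` for an output bound `s` of `Q`, i.e. `ttBudget q s`); `adLang_mem_PRelClass`,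
  `adLang_mem_P`.

A first version of this file (same declarations, pre-2026-08-14 namespaces) was reviewed as
p14415 and bounced only for the namespace migration; this is its re-creation in the current tree.

## References

* R. E. Ladner, N. A. Lynch, A. L. Selman, *A comparison of polynomial time reducibilities*,
  Theoret. Comput. Sci. 1 (1975) 103–123, §2 (`≤ᵖ_T`).
* S. Arora, B. Barak, *Computational Complexity: A Modern Approach*, CUP 2009, §3.4 (oracle
  machines), §17.2.1 (binary search with a `PP` oracle).
-/

namespace Literature.Computability.Complexity

open _root_.Computability Polynomial PRelSigma OracleCompose TTClosure

namespace AdQuery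

section Defs

variable (Q : List Bool → List Bool) (q : Polynomial ℕ) (D : Language Bool)

/-- **The answer bits of an adaptive reduction**: `adBits Q A x i` are the first `i` answers, the
`i`-th query being `Q ⟨x, adBits Q A x i⟩`. [Arora–Barak 2009, §3.4] [folklore] -/
noncomputable def adBits (A : Language Bool) (x : List Bool) : ℕ → List Bool
  | 0 => []
  | i + 1 => adBits A x i ++ [A.boolIndicator (Q (boolPair x (adBits A x i)))]

/-- **The language of a bounded adaptive reduction** to `A`: `x` is a member iff
`⟨x, adBits … (q |x|)⟩ ∈ D`. [Ladner–Lynch–Selman 1975, §2 (`≤ᵖ_T`)] [cite: LadnerLynchSelman1975, §2] -/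
def adLang (A : Language Bool) : Language Bool :=
  {x | boolPair x (adBits Q A x (q.eval x.length)) ∈ D}

/-- **The adaptive oracle algorithm**: while fewer than `q(|x|)` answers have been received, ask
`Q ⟨x, answers⟩` (answers flattened to a bit string); then output `[⟨x, answers⟩ ∈ D]`.
[Ladner–Lynch–Selman 1975, §2; Arora–Barak 2009, §3.4] [cite: LadnerLynchSelman1975, §2] -/
noncomputable def adAlg : OracleAlg Bool where
  step x ans :=
    if ans.length < q.eval x.length then Sum.inl (Q (boolPair x ans.flatten))
    else Sum.inr (D.boolIndicator (boolPair x ans.flatten))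

end Defs

variable {Q : List Bool → List Bool} {q : Polynomial ℕ} {D : Language Bool}

/-- `adBits … 0 = []`. [folklore] -/
@[simp] theorem adBits_zero (A : Language Bool) (x : List Bool) : adBits Q A x 0 = [] := rfl

/-- One more answer bit. [folklore] -/
theorem adBits_succ (A : Language Bool) (x : List Bool) (i : ℕ) :
    adBits Q A x (i + 1) = adBits Q A x i ++ [A.boolIndicator (Q (boolPair x (adBits Q A x i)))] := rfl

/-- `adBits … i` has `i` entries. [folklore] -/
@[simp] theorem length_adBits (A : Language Bool) (x : List Bool) : ∀ i, (adBits Q A x i).length = i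
  | 0 => rfl
  | i + 1 => by rw [adBits_succ, List.length_append, length_adBits A x i, List.length_singleton]

/-- Earlier answer bits are a prefix of later ones. [folklore] -/
theorem adBits_take (A : Language Bool) (x : List Bool) {i j : ℕ} (h : i ≤ j) :
    (adBits Q A x j).take i = adBits Q A x i := by
  induction j with
  | zero =>
    obtain rfl : i = 0 := Nat.le_zero.1 h
    rfl
  | succ j ih =>
    rcases Nat.lt_or_eq_of_le h with hlt | rfl
    · rw [adBits_succ, List.take_append_of_le_length (by rw [length_adBits]; omega)]
      exact ih (by omega)
    · rw [List.take_of_length_le (by rw [length_adBits])]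

/-- Unfolding lemma for `adLang`. [folklore] -/
theorem mem_adLang_iff {A : Language Bool} {x : List Bool} :
    x ∈ adLang Q q D A ↔ boolPair x (adBits Q A x (q.eval x.length)) ∈ D :=
  Iff.rfl

/-- The step of `adAlg` before the last query has been answered is the next query. [folklore] -/
theorem adAlg_step_of_lt (x : List Bool) {ans : List (List Bool)} (h : ans.length < q.eval x.length) :
    (adAlg Q q D).step x ans = Sum.inl (Q (boolPair x ans.flatten)) := by
  simp [adAlg, h]

/-- The step of `adAlg` after all answers is the verdict. [folklore] -/
theorem adAlg_step_of_le (x : List Bool) {ans : List (List Bool)} (h : q.eval x.length ≤ ans.length) :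
    (adAlg Q q D).step x ans = Sum.inr (D.boolIndicator (boolPair x ans.flatten)) := by
  simp [adAlg, Nat.not_lt.2 h]

/-- **The transcript of `adAlg` is the list of answer bits.** [folklore] -/
theorem trans_adAlg (A : Language Bool) (x : List Bool) :
    ∀ i ≤ q.eval x.length, trans (adAlg Q q D) (Oracle.ofLanguage A) x i = bitsTrans (adBits Q A x i)
  | 0, _ => by simp
  | i + 1, hi => by
    have ih := trans_adAlg A x i (Nat.le_of_succ_le hi)
    rw [trans_succ, ih, qryOf_eq_of_step_eq (adAlg_step_of_lt x (by simpa using hi)),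
      ofLanguage_eq_singleton, adBits_succ, bitsTrans_append, bitsTrans_singleton, flatten_bitsTrans]

/-- **`adAlg` decides `adLang`** within any budget of more than `q(|x|)` rounds.
[Ladner–Lynch–Selman 1975, §2] [cite: LadnerLynchSelman1975, §2] -/
theorem run_adAlg (A : Language Bool) (x : List Bool) {n : ℕ} (hn : q.eval x.length < n) :
    (adAlg Q q D).run (Oracle.ofLanguage A) n x = some ((adLang Q q D A).boolIndicator x) := by
  rw [run_eq_some_iff]
  refine ⟨q.eval x.length, hn, fun i hi => ⟨Q (boolPair x (adBits Q A x i)), ?_⟩, ?_⟩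
  · rw [trans_adAlg A x i hi.le, adAlg_step_of_lt x (by simpa using hi), flatten_bitsTrans]
  · rw [trans_adAlg A x _ le_rfl, adAlg_step_of_le x (by simp), flatten_bitsTrans]
    rfl

/-- **The queries of `adAlg` are the intended ones**: every recorded query is `Q ⟨x, adBits … i⟩`
for some `i < q(|x|)`. [folklore] -/
theorem exists_of_mem_queries_adAlg (A : Language Bool) (x : List Bool) {n : ℕ} {y : List Bool}
    (hy : y ∈ (adAlg Q q D).queries (Oracle.ofLanguage A) n x) :
    ∃ i < q.eval x.length, y = Q (boolPair x (adBits Q A x i)) := by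
  obtain ⟨i, -, hall, rfl⟩ := exists_of_mem_queries _ _ n x y hy
  have hi : i < q.eval x.length := by
    by_contra hle
    obtain ⟨y', hy'⟩ := hall (q.eval x.length) (Nat.not_lt.1 hle)
    rw [trans_adAlg A x _ le_rfl, adAlg_step_of_le x (by simp)] at hy'
    cases hy'
  refine ⟨i, hi, ?_⟩
  rw [trans_adAlg A x i hi.le, qryOf_eq_of_step_eq (adAlg_step_of_lt x (by simpa using hi)), flatten_bitsTrans]

/-! ### The step function of `adAlg` as a string map -/

section Step

variable (Q q D)

/-- The code `0 · Q ⟨x, flattened answers⟩` of the next query. [folklore] -/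
noncomputable def adQryS : List Bool → List Bool := List.cons false ∘ Q ∘ pairFn fstP (flatT.eval ∘ bodA)

/-- **The step function of `adAlg` as a string map**: guarded by "fewer than `q(|x|)` answers",
the query code, else the verdict code of `TruthTableClosure.decS`. [folklore] -/
noncomputable def adStepS : List Bool → List Bool := condFn (GoOn q) (adQryS Q) (decS D)

variable {Q q D}

/-- `adQryS Q ∈ FP` for `Q ∈ FP`. [folklore] -/
theorem adQryS_mem_FP (hQ : Q ∈ FP) : adQryS Q ∈ FP :=
  comp_mem_FP (cons_mem_FP false) (comp_mem_FP hQ (pairFn_mem_FP fstP_mem_FP (comp_mem_FP flatT_mem_FP bodA_mem_FP)))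

/-- **`adStepS ∈ FP`.** [folklore] -/
theorem adStepS_mem_FP (hQ : Q ∈ FP) (hD : D ∈ Classes.P) : adStepS Q q D ∈ FP :=
  condFn_mem_FP (GoOn_mem_P q) (adQryS_mem_FP hQ) (decS_mem_FP hD)

/-- The query branch computes the query code. [folklore] -/
theorem adQryS_apply (x : List Bool) (ans : List (List Bool)) :
    adQryS Q (boolPair x ((encodingList Bool).listBool.encode ans)) = false :: Q (boolPair x ans.flatten) := by
  rw [adQryS, Function.comp_apply, Function.comp_apply, pairFn_apply, fstP_boolPair, Function.comp_apply, bodA_apply,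
    flatT_eval_body]

/-- **The string map computes the step function.** [folklore] -/
theorem adStepS_apply (x : List Bool) (ans : List (List Bool)) :
    adStepS Q q D (boolPair x ((encodingList Bool).listBool.encode ans)) = stepCode ((adAlg Q q D).step x ans) := by
  by_cases h : ans.length < q.eval x.length
  · rw [adStepS, condFn_of_mem _ _ ((mem_GoOn_iff x ans).2 h), adAlg_step_of_lt x h, adQryS_apply, stepCode_inl]
  · rw [adStepS, condFn_of_not_mem _ _ (fun h' => h ((mem_GoOn_iff x ans).1 h')),
      adAlg_step_of_le x (Nat.not_lt.1 h), decS_apply, stepCode_inr]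

/-- **`adAlg` is polynomial-time** for `Q ∈ FP` and `D ∈ P`. [Arora–Barak 2009, §3.4] [cite: AroraBarak2009, §3.4] -/
theorem isPolyTime_adAlg (hQ : Q ∈ FP) (hD : D ∈ Classes.P) : (adAlg Q q D).IsPolyTime encodingBoolBool := by
  obtain ⟨p, Mx, h⟩ := adStepS_mem_FP (q := q) hQ hD
  refine ⟨p, Mx, fun z => ?_⟩
  have hz := h (boolPair z.1 ((encodingList Bool).listBool.encode z.2))
  rw [id, adStepS_apply] at hz
  exact hz

end Step

/-! ### Main results -/

/-- **Bounded adaptive reductions are Turing reductions**: `adLang Q q D A ∈ P^A` for `Q ∈ FP`,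
`D ∈ P` — round budget `q + 1`, queries `Q ⟨x, bits⟩` with `|bits| < q(|x|)`, hence of length
`≤ s(2|x| + 2 + q|x|)` for an output bound `s` of `Q` (`ttBudget q s`).
(Ladner–Lynch–Selman 1975, §2, `≤ᵖ_T`; Arora–Barak 2009, §3.4.) [cite: LadnerLynchSelman1975, §2] -/
theorem adLang_mem_PRel (hQ : Q ∈ FP) (hD : D ∈ Classes.P) (A : Language Bool) :
    adLang Q q D A ∈ PRel (Oracle.ofLanguage A) := by
  obtain ⟨s, hs⟩ := exists_poly_length_le_of_mem_FP hQ
  refine ⟨adAlg Q q D, isPolyTime_adAlg hQ hD, ttBudget q s, fun x => ⟨?_, fun y hy => ?_⟩⟩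
  · exact run_adAlg A x (by rw [ttBudget_eval]; omega)
  · obtain ⟨i, hi, rfl⟩ := exists_of_mem_queries_adAlg A x hy
    refine (hs _).trans ?_
    rw [ttBudget_eval, length_boolPair, length_adBits]
    exact (TM2Iter.eval_mono s (by omega)).trans (Nat.le_add_left _ _)

/-- `adLang Q q D A ∈ P^C` for `A ∈ C`. [Ladner–Lynch–Selman 1975, §2] [cite: LadnerLynchSelman1975, §2] -/
theorem adLang_mem_PRelClass (hQ : Q ∈ FP) (hD : D ∈ Classes.P) {C : Set (Language Bool)} {A : Language Bool}
    (hA : A ∈ C) : adLang Q q D A ∈ PRelClass C :=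
  mem_PRelClass_iff.2 ⟨A, hA, adLang_mem_PRel hQ hD A⟩

/-- `adLang Q q D A ∈ P` for `A ∈ P` (`P^P = P`). [Ladner–Lynch–Selman 1975, §2] [cite: LadnerLynchSelman1975, §2] -/
theorem adLang_mem_P (hQ : Q ∈ FP) (hD : D ∈ Classes.P) {A : Language Bool} (hA : A ∈ Classes.P) :
    adLang Q q D A ∈ Classes.P :=
  PRelClass_P_subset_P (adLang_mem_PRelClass hQ hD hA)

end AdQuery

end Literature.Computability.Complexity
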